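import Mathlib
import Summits.ResolutionOfSingularities.ResolutionOfSingularities.Theorems.RadicialJungCleanModelsContactChainGenericType
import Literature.AlgebraicGeometry.Resolution.StrictNormalCrossingsFlatDescent
import Literature.AlgebraicGeometry.Resolution.StalkSpecializesLocalization
import Literature.AlgebraicGeometry.Motives.CartierDivisorClassPullback
import HarnessLib

/-!
# Route `RadicialJung`, crux `CleanModels` (stmt-ResolutionOfSingularities-15917), line `Sketch` rev 35, stub 6 `stub_cleanProp44` (X44c),
# work plan O8 / L7b — in X44c's own currency: cleanness at every point of the stage ⟹ exit ∨ the (T2b) bad pair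

Memo `Cruxes/CleanModels/Lines/Sketch-memo-hand2-g8-stubs-5-7.md` §2.  The ring-level theorem ✓ `exists_pointChain_cleanPermissibleAt_or_badPair_of_cleanRegAt_generic`
(`…ContactChainGenericType.lean`) is instantiated at the local ring of the GENERIC POINT `η` of the curve `C₀ = cl{η}`: `𝒪_{X₀,η}` is the localization
of `𝒪_{X₀,x₀}` at `𝓘_{C₀,x₀}` (✓ `isLocalizationAtPrime_stalkSpecializes`, ✓ `stalkIdeal_vanishingIdeal_closure`: `𝓘_{cl{η},x₀} = 𝔭_η`) compatibly
with the maps to `K(X₀)` (✓ `toFunctionField_stalkSpecializes`).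

* `exists_pointChain_cleanPermissibleAt_or_badPair_of_cleanRegAt_genericPoint` — `CleanRegAt p (toFunctionField η) G` at the generic point `η` of
  `C₀` ⟹ exit ∨ bad pair;
* `exists_pointChain_cleanPermissibleAt_or_badPair_of_forall_cleanRegAt` — **X44c's standing hypothesis «the line of `G` is clean-regular at EVERY
  point of the (regular, quasi-excellent) stage `X₀`» ⟹ at every closed point `x₀` (`dim 𝒪_{X₀,x₀} = 3`) of every irreducible regular curve `C₀`:
  EITHER a dominant chain of point blowing ups following `C₀` reaches a point where the line is clean-permissible for the strict transform of `C₀`,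
  OR the (T2b) bad pair** (`v · q₀^{a₀} q₁^{a₁}`, `v ∉ 𝓘`, `q_j ∈ 𝓘 ∖ 𝓘²`, `p ∤ a_j`, `e·𝓘 ⊆ (q₀,q₁)` for some `e ∉ 𝓘`, `(q₀,q₁) ≠ 𝓘`, `𝓘 = 𝓘_{C₀,x₀}`),
  which moreover satisfies the first-order residual of ✓ `…ContactChainResidualLine.lean` (every integral representative is a `p`-th power modulo `𝓘²`).

So L7b (O8 of the X44c work plan) is now reduced, in the kernel and in X44c's own hypotheses, to the single configuration (T2b) of the memo.
Honest framing: OURS; nothing here proves resolution in characteristic `p`, X44c, or any case of `CleanModels`.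
-/

noncomputable section

set_option linter.dupNamespace false -- mandated namespace of this single-conjunct summit

open CategoryTheory AlgebraicGeometry TopologicalSpace IsLocalRing
open Literature.AlgebraicGeometry.Resolution Literature.AlgebraicGeometry.Motives
open Scheme.IdealSheafData

namespace Summit.ResolutionOfSingularities.ResolutionOfSingularities.Theorems.RadicialJung.CleanModels

/-- **Cleanness at the generic point of the curve ⟹ exit ∨ bad pair.**  See the module docstring. [cite: CossartJannsenSaito2020, proof of Thm. 6.28, Step 5]
[cite: StacksProject, Tag 01J7] [cite: Piltant2013, §2 Axiom 4] -/
theorem exists_pointChain_cleanPermissibleAt_or_badPair_of_cleanRegAt_genericPoint {X₀ : Scheme.{0}} [IsIntegral X₀] [IsLocallyNoetherian X₀]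
    (hX₀ : Scheme.IsRegular X₀) (hE : Scheme.IsQuasiExcellent X₀) (p : ℕ) [hp : Fact p.Prime] [CharP X₀.functionField p] {C₀ : Closeds X₀}
    (hC₀reg : ∀ y ∈ (C₀ : Set X₀), ∃ c : Fin 2 → X₀.presheaf.stalk y,
      IsRsopPart c ∧ Ideal.span (Set.range c) = stalkIdeal (vanishingIdeal C₀) y)
    {η : X₀} (hη : (C₀ : Set X₀) = closure {η})
    {x₀ : X₀} (hx₀ : IsClosed ({x₀} : Set X₀)) (hx₀C : x₀ ∈ (C₀ : Set X₀)) (hdim₀ : ringKrullDim (X₀.presheaf.stalk x₀) = 3)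
    [hP : (stalkIdeal (vanishingIdeal C₀) x₀).IsPrime]
    (w : X₀.presheaf.stalk x₀) (hw : stalkIdeal (vanishingIdeal C₀) x₀ ⊔ Ideal.span {w} = maximalIdeal _)
    (G : X₀.functionField) (hGη : CleanRegAt p (RatFn.toFunctionField η) G) :
    (∃ (X : Scheme.{0}) (_ : IsIntegral X) (_ : IsLocallyNoetherian X) (σ : X ⟶ X₀) (_ : IsDominant σ) (C : Closeds X) (x : X)
        (n : ℕ), IsPointChainAlong σ C₀ C x n ∧ σ x = x₀ ∧ IsClosed ({x} : Set X) ∧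
        CleanPermissibleAt p (RatFn.toFunctionField x) (RatFn.functionFieldMap σ G) (stalkIdeal (vanishingIdeal C) x)) ∨
      ∃ (cc : Fin p → X₀.functionField) (v : X₀.presheaf.stalk x₀) (q : Fin 2 → X₀.presheaf.stalk x₀) (a : Fin 2 → ℕ)
        (e : X₀.presheaf.stalk x₀),
        (∃ j : Fin p, (j : ℕ) ≠ 0 ∧ cc j ≠ 0) ∧
        (∑ j : Fin p, cc j ^ p * G ^ (j : ℕ)) = RatFn.toFunctionField x₀ (v * ∏ i, q i ^ a i) ∧
        v ∉ stalkIdeal (vanishingIdeal C₀) x₀ ∧ (∀ i, q i ∈ stalkIdeal (vanishingIdeal C₀) x₀) ∧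
        (∀ i, q i ∉ stalkIdeal (vanishingIdeal C₀) x₀ ^ 2) ∧ (∀ i, ¬ p ∣ a i) ∧
        e ∉ stalkIdeal (vanishingIdeal C₀) x₀ ∧ Ideal.span {e} * stalkIdeal (vanishingIdeal C₀) x₀ ≤ Ideal.span (Set.range q) ∧
        Ideal.span (Set.range q) ≠ stalkIdeal (vanishingIdeal C₀) x₀ := by
  have h : η ⤳ x₀ := by rw [specializes_iff_mem_closure, ← hη]; exact hx₀C
  have hC₀ : C₀ = ⟨closure {η}, isClosed_closure⟩ := Closeds.ext hη
  have hPeq : stalkIdeal (vanishingIdeal C₀) x₀ = primeOfSpecializes h := by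
    rw [hC₀]; exact stalkIdeal_vanishingIdeal_closure h
  letI : Algebra (X₀.presheaf.stalk x₀) (X₀.presheaf.stalk η) := (X₀.presheaf.stalkSpecializes h).hom.toAlgebra
  haveI : IsLocalization.AtPrime (X₀.presheaf.stalk η) (stalkIdeal (vanishingIdeal C₀) x₀) := by
    have key := Literature.AlgebraicGeometry.Resolution.isLocalizationAtPrime_stalkSpecializes h
    have hM : (stalkIdeal (vanishingIdeal C₀) x₀).primeCompl = (primeOfSpecializes h).primeCompl := by
      ext x
      change x ∉ stalkIdeal (vanishingIdeal C₀) x₀ ↔ x ∉ primeOfSpecializes h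
      rw [hPeq]
    change IsLocalization _ _
    rw [hM]
    exact key
  have hf : ∀ a, RatFn.toFunctionField η (algebraMap (X₀.presheaf.stalk x₀) (X₀.presheaf.stalk η) a) = RatFn.toFunctionField x₀ a :=
    fun a => RatFn.toFunctionField_stalkSpecializes h a
  exact exists_pointChain_cleanPermissibleAt_or_badPair_of_cleanRegAt_generic hX₀ hE p hC₀reg hx₀ hx₀C hdim₀ w hw (X₀.presheaf.stalk η)
    (RatFn.toFunctionField η) hf G hGη

/-- **L7b in X44c's currency.**  On a regular integral quasi-excellent `X₀` (`char K(X₀) = p`) on which the line of `G` is clean-regular at EVERY point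
(the standing hypothesis of `stub_cleanProp44`), let `C₀` be an irreducible regular curve, `x₀ ∈ C₀` a closed point with `dim 𝒪_{X₀,x₀} = 3` and `w` a
transversal parameter.  Then EITHER a dominant chain of point blowing ups following `C₀` ends at a point where the line is clean-permissible for the
strict transform of `C₀`, OR the line is in the (T2b) bad-pair configuration at `x₀` AND every integral representative of the line at `x₀` is a `p`-th
power modulo `𝓘²_{C₀,x₀}`. [cite: CossartJannsenSaito2020, proof of Thm. 6.28, Step 5] [cite: CossartPiltant2008, Prop. 4.4 (proof, p. 10)]
[cite: Piltant2013, §2 Axiom 4] -/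
theorem exists_pointChain_cleanPermissibleAt_or_badPair_of_forall_cleanRegAt {X₀ : Scheme.{0}} [IsIntegral X₀] [IsLocallyNoetherian X₀]
    (hX₀ : Scheme.IsRegular X₀) (hE : Scheme.IsQuasiExcellent X₀) (p : ℕ) [hp : Fact p.Prime] [CharP X₀.functionField p]
    (G : X₀.functionField) (hclean : ∀ x : X₀, CleanRegAt p (RatFn.toFunctionField x) G)
    {C₀ : Closeds X₀} (hC₀irr : IsIrreducible (C₀ : Set X₀))
    (hC₀reg : ∀ y ∈ (C₀ : Set X₀), ∃ c : Fin 2 → X₀.presheaf.stalk y,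
      IsRsopPart c ∧ Ideal.span (Set.range c) = stalkIdeal (vanishingIdeal C₀) y)
    {x₀ : X₀} (hx₀ : IsClosed ({x₀} : Set X₀)) (hx₀C : x₀ ∈ (C₀ : Set X₀)) (hdim₀ : ringKrullDim (X₀.presheaf.stalk x₀) = 3)
    [hP : (stalkIdeal (vanishingIdeal C₀) x₀).IsPrime]
    (w : X₀.presheaf.stalk x₀) (hw : stalkIdeal (vanishingIdeal C₀) x₀ ⊔ Ideal.span {w} = maximalIdeal _) :
    (∃ (X : Scheme.{0}) (_ : IsIntegral X) (_ : IsLocallyNoetherian X) (σ : X ⟶ X₀) (_ : IsDominant σ) (C : Closeds X) (x : X)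
        (n : ℕ), IsPointChainAlong σ C₀ C x n ∧ σ x = x₀ ∧ IsClosed ({x} : Set X) ∧
        CleanPermissibleAt p (RatFn.toFunctionField x) (RatFn.functionFieldMap σ G) (stalkIdeal (vanishingIdeal C) x)) ∨
      ((∀ (cc : Fin p → X₀.functionField) (R : X₀.presheaf.stalk x₀), (∃ j : Fin p, (j : ℕ) ≠ 0 ∧ cc j ≠ 0) →
          (∑ j : Fin p, cc j ^ p * G ^ (j : ℕ)) = RatFn.toFunctionField x₀ R →
          ∃ c : X₀.presheaf.stalk x₀, R - c ^ p ∈ stalkIdeal (vanishingIdeal C₀) x₀ ^ 2) ∧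
      ∃ (cc : Fin p → X₀.functionField) (v : X₀.presheaf.stalk x₀) (q : Fin 2 → X₀.presheaf.stalk x₀) (a : Fin 2 → ℕ)
        (e : X₀.presheaf.stalk x₀),
        (∃ j : Fin p, (j : ℕ) ≠ 0 ∧ cc j ≠ 0) ∧
        (∑ j : Fin p, cc j ^ p * G ^ (j : ℕ)) = RatFn.toFunctionField x₀ (v * ∏ i, q i ^ a i) ∧
        v ∉ stalkIdeal (vanishingIdeal C₀) x₀ ∧ (∀ i, q i ∈ stalkIdeal (vanishingIdeal C₀) x₀) ∧
        (∀ i, q i ∉ stalkIdeal (vanishingIdeal C₀) x₀ ^ 2) ∧ (∀ i, ¬ p ∣ a i) ∧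
        e ∉ stalkIdeal (vanishingIdeal C₀) x₀ ∧ Ideal.span {e} * stalkIdeal (vanishingIdeal C₀) x₀ ≤ Ideal.span (Set.range q) ∧
        Ideal.span (Set.range q) ≠ stalkIdeal (vanishingIdeal C₀) x₀) := by
  classical
  -- the generic point of the irreducible closed `C₀`
  obtain ⟨η, hη⟩ := QuasiSober.sober hC₀irr C₀.isClosed
  have hη' : (C₀ : Set X₀) = closure {η} := hη.symm
  by_cases hres : ∀ (cc : Fin p → X₀.functionField) (R : X₀.presheaf.stalk x₀), (∃ j : Fin p, (j : ℕ) ≠ 0 ∧ cc j ≠ 0) →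
      (∑ j : Fin p, cc j ^ p * G ^ (j : ℕ)) = RatFn.toFunctionField x₀ R →
      ∃ c : X₀.presheaf.stalk x₀, R - c ^ p ∈ stalkIdeal (vanishingIdeal C₀) x₀ ^ 2
  · rcases exists_pointChain_cleanPermissibleAt_or_badPair_of_cleanRegAt_genericPoint hX₀ hE p hC₀reg hη' hx₀ hx₀C hdim₀ w hw G (hclean η)
      with hexit | hbad
    · exact Or.inl hexit
    · exact Or.inr ⟨hres, hbad⟩
  · left
    push Not at hres
    obtain ⟨cc, R, hcc, hX, hR⟩ := hres
    exact exists_pointChain_cleanPermissibleAt_of_rep_not_pow_mod_sq hX₀ hE p hC₀reg hx₀ hx₀C hdim₀ w hw G cc hcc R hX hR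

end Summit.ResolutionOfSingularities.ResolutionOfSingularities.Theorems.RadicialJung.CleanModels

end
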